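import Mathlib.LinearAlgebra.Matrix.PosDef
import Mathlib.LinearAlgebra.Matrix.Charpoly.Coeff
import Mathlib.LinearAlgebra.Matrix.ToLinearEquiv
import Mathlib.NumberTheory.NumberField.InfinitePlace.Embeddings
import Literature.NumberTheory.NumberFields.RootOfUnityCongruence
import HarnessLib

/-!
# Rigidity of isometries: a unipotent isometry of a definite form is trivial; unimodular algebraic
# integers `≡ 1 (mod N)`, `N ≥ 3`, are `1`

Topic `GroupTheory/ArithmeticGroups`; namespace `Literature.GroupTheory.ArithmeticGroups`.  Theorems only.

Two elementary rigidity statements behind «neat levels act freely» ([Deligne1971TravauxShimura] proof of Prop. 1.15;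
[Milne2005ShimuraVarieties] Prop. 3.5 / proof of Thm. 5.17: the stabiliser of a point of a hermitian symmetric domain is
COMPACT, an arithmetic group is DISCRETE, and a principal congruence subgroup of level `N ≥ 3` is TORSION-FREE
(Minkowski / Serre)), in a form that needs neither compactness nor discreteness:

* `eq_one_of_isometry_of_pow_sub_one_eq_zero` — an isometry `q` of a positive definite real symmetric bilinear form
  with `(q - 1)^k = 0` is `q = 1` (the `S`-norm of `(q-1) z` vanishes when `(q-1)² z = 0`);
* `norm_eq_one_of_isRoot_charpoly_of_isometry` — every complex eigenvalue of such an isometry has absolute value `1`;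
* `eq_one_of_norm_eq_one_of_dvd_sub_one` — KRONECKER + the root-of-unity congruence: a complex root `λ` of a
  RATIONAL polynomial all of whose complex roots are unimodular, with `(λ - 1)/N` an algebraic integer, `N ≥ 3`, is
  `λ = 1` (Mathlib `NumberField.Embeddings.pow_eq_one_of_norm_eq_one` + the tree's
  `RingOfIntegers.eq_one_of_isOfFinOrder_of_dvd_sub_one`).

* `eq_one_of_isometry_of_charpoly_integral` — ASSEMBLY: a rational isometry `q` of a positive definite form with
  `charpoly ((q-1)/N) ∈ ℤ[X]`, `N ≥ 3`, is `q = 1`.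

They are consumed by the Siegel-side leaf (principal level `K_δ(N)` acts freely on `Sh_{K_δ(N′)}(ℂ)`,
cell hodgecm-mathlib row I-1′, `F1ExtHodgeType` v4 `stub_S2inj` Step B3 / leaf Q3).  HC_CM is proved only modulo the 7
printed citations until rung 0 closes; this file proves no cell binder (banked generic leaf, no floor change).

## References
* [Milne2005ShimuraVarieties] J. S. Milne, *Introduction to Shimura Varieties* (2005), Prop. 3.5, Thm. 5.17 and its
  proof (torsion-free ⇒ free action), §3 «neat».
* [Deligne1971TravauxShimura] P. Deligne, *Travaux de Shimura* (1971), proof of Prop. 1.15 p. 132.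
* [Minkowski1887] H. Minkowski, *Zur Theorie der positiven quadratischen Formen*, J. reine angew. Math. 101 (1887), §1.
-/

noncomputable section

open Matrix Polynomial

namespace Literature.GroupTheory.ArithmeticGroups

variable {n : Type*} [Fintype n] [DecidableEq n]

/-! ### A unipotent isometry of a positive definite form is the identity -/

/-- For an isometry `q` (`qᵀ S q = S`) of a positive definite real symmetric matrix `S`: if `(q - 1)² z = 0` then
`(q - 1) z = 0` — the vector `w = (q-1) z` is `q`-fixed, so `⟨w, w⟩_S = ⟨q w, q z⟩_S - ⟨w, z⟩_S = 0`.
[cite: Milne2005ShimuraVarieties, Prop. 3.5 and proof of Thm. 5.17] -/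
theorem mulVec_sub_one_eq_zero_of_sq {S q : Matrix n n ℝ} (hS : S.PosDef) (hq : qᵀ * S * q = S) {z : n → ℝ}
    (hz : ((q - 1) * (q - 1)) *ᵥ z = 0) : (q - 1) *ᵥ z = 0 := by
  set w := (q - 1) *ᵥ z with hw
  -- `q w = w`
  have hqw : q *ᵥ w = w := by
    have h1 : (q - 1) *ᵥ w = 0 := by rw [hw, Matrix.mulVec_mulVec]; exact hz
    rw [Matrix.sub_mulVec, Matrix.one_mulVec, sub_eq_zero] at h1
    exact h1
  -- the `S`-pairing is `q`-invariant: `⟨q u, q v⟩ = ⟨u, v⟩`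
  have hiso : ∀ u v : n → ℝ, (q *ᵥ u) ⬝ᵥ (S *ᵥ (q *ᵥ v)) = u ⬝ᵥ (S *ᵥ v) := by
    intro u v
    rw [Matrix.mulVec_mulVec, Matrix.dotProduct_mulVec, Matrix.vecMul_mulVec, ← Matrix.mul_assoc, hq,
      ← Matrix.dotProduct_mulVec]
  -- `⟨w, w⟩ = ⟨w, q z⟩ - ⟨w, z⟩ = ⟨q w, q z⟩ - ⟨w, z⟩ = 0`
  have hzero : w ⬝ᵥ (S *ᵥ w) = 0 := by
    have h1 : w ⬝ᵥ (S *ᵥ w) = w ⬝ᵥ (S *ᵥ (q *ᵥ z)) - w ⬝ᵥ (S *ᵥ z) := by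
      rw [hw, Matrix.sub_mulVec, Matrix.one_mulVec, Matrix.mulVec_sub, dotProduct_sub]
    rw [h1, sub_eq_zero]
    conv_lhs => rw [← hqw]
    exact hiso w z
  by_contra hne
  have hpos := hS.dotProduct_mulVec_pos hne
  rw [star_trivial, hzero] at hpos
  exact lt_irrefl _ hpos

/-- **A unipotent isometry of a positive definite form is the identity**: `S` positive definite real symmetric,
`qᵀ S q = S` and `(q - 1)^k = 0` for some `k` ⟹ `q = 1`. [cite: Milne2005ShimuraVarieties, Prop. 3.5 and proof of Thm. 5.17] -/
theorem eq_one_of_isometry_of_pow_sub_one_eq_zero {S q : Matrix n n ℝ} (hS : S.PosDef) (hq : qᵀ * S * q = S)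
    {k : ℕ} (hk : (q - 1) ^ k = 0) : q = 1 := by
  -- `(q-1)^(j+1) z = 0 → (q-1) z = 0`, by induction on `j`
  have key : ∀ (j : ℕ) (z : n → ℝ), ((q - 1) ^ (j + 1)) *ᵥ z = 0 → (q - 1) *ᵥ z = 0 := by
    intro j
    induction j with
    | zero => intro z hz; simpa using hz
    | succ j ih =>
      intro z hz
      -- `(q-1)^(j+2) z = (q-1)^(j+1) ((q-1) z)`... regroup as `((q-1)^2) ((q-1)^j z) = 0`
      have h1 : ((q - 1) ^ (j + 1)) *ᵥ ((q - 1) *ᵥ z) = 0 := by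
        rw [Matrix.mulVec_mulVec, ← pow_succ]; exact hz
      have h2 := ih _ h1
      -- now `(q-1) ((q-1) z) = 0`, i.e. `(q-1)² z = 0`
      have h3 : ((q - 1) * (q - 1)) *ᵥ z = 0 := by rw [← Matrix.mulVec_mulVec]; exact h2
      exact mulVec_sub_one_eq_zero_of_sq hS hq h3
  have hall : ∀ z : n → ℝ, (q - 1) *ᵥ z = 0 := by
    intro z
    rcases k with _ | k
    · -- `(q-1)^0 = 1 = 0`: the ring is trivial, so `n` is empty and everything is `0`
      have h0 : (1 : Matrix n n ℝ) = 0 := by simpa using hk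
      have : (q - 1) = 0 := by rw [← mul_one (q - 1), h0, mul_zero]
      rw [this, Matrix.zero_mulVec]
    · exact key k z (by rw [hk, Matrix.zero_mulVec])
  have hq1 : q - 1 = 0 := by
    ext i j
    have := congrFun (hall (Pi.single j 1)) i
    rw [Matrix.mulVec_single_one] at this
    simpa using this
  exact sub_eq_zero.1 hq1

/-! ### Complex eigenvalues of an isometry of a positive definite real form are unimodular -/

omit [DecidableEq n] in
/-- The hermitian pairing `v̄ᵀ S v` on `ℂⁿ` of a positive definite REAL symmetric `S` has positive real part at
`v ≠ 0` (`= aᵀ S a + bᵀ S b` for `v = a + i b`). [folklore] -/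
private theorem re_star_dotProduct_map_mulVec_pos {S : Matrix n n ℝ} (hS : S.PosDef) {v : n → ℂ} (hv : v ≠ 0) :
    0 < (star v ⬝ᵥ ((S.map (algebraMap ℝ ℂ)) *ᵥ v)).re := by
  set a : n → ℝ := fun i => (v i).re with ha
  set b : n → ℝ := fun i => (v i).im with hb
  have hre : (star v ⬝ᵥ ((S.map (algebraMap ℝ ℂ)) *ᵥ v)).re = a ⬝ᵥ (S *ᵥ a) + b ⬝ᵥ (S *ᵥ b) := by
    simp only [dotProduct, Matrix.mulVec, Matrix.map_apply, Complex.re_sum, Pi.star_apply,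
      Finset.mul_sum, Complex.mul_re, Complex.star_def, Complex.conj_re, Complex.conj_im,
      Complex.coe_algebraMap, Complex.ofReal_re, Complex.ofReal_im, Complex.mul_im, ha, hb]
    rw [← Finset.sum_add_distrib]
    refine Finset.sum_congr rfl fun i _ => ?_
    rw [← Finset.sum_add_distrib]
    refine Finset.sum_congr rfl fun j _ => ?_
    ring
  rw [hre]
  have hab : a ≠ 0 ∨ b ≠ 0 := by
    by_contra h
    push Not at h
    apply hv
    funext i
    apply Complex.ext
    · simpa [ha] using congrFun h.1 i
    · simpa [hb] using congrFun h.2 i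
  have hpsd := hS.posSemidef
  rcases hab with h | h
  · have h1 := hS.dotProduct_mulVec_pos h
    have h2 := hpsd.dotProduct_mulVec_nonneg b
    rw [star_trivial] at h1 h2
    linarith
  · have h1 := hpsd.dotProduct_mulVec_nonneg a
    have h2 := hS.dotProduct_mulVec_pos h
    rw [star_trivial] at h1 h2
    linarith

/-- **Complex eigenvalues of an isometry of a positive definite real form are unimodular**: `S` positive definite
real symmetric, `qᵀ S q = S`, `z ∈ ℂ` a root of the characteristic polynomial of `q` ⟹ `‖z‖ = 1` (an eigenvector `v`
has `v̄ᵀ S v = (q̄ v̄)ᵀ S (q v) = |z|² v̄ᵀ S v` and `v̄ᵀ S v ≠ 0`). [cite: Milne2005ShimuraVarieties, Prop. 3.5] -/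
theorem norm_eq_one_of_isRoot_charpoly_of_isometry {S q : Matrix n n ℝ} (hS : S.PosDef) (hq : qᵀ * S * q = S)
    {z : ℂ} (hz : ((q.map (algebraMap ℝ ℂ)).charpoly).IsRoot z) : ‖z‖ = 1 := by
  set qC : Matrix n n ℂ := q.map (algebraMap ℝ ℂ) with hqC
  set SC : Matrix n n ℂ := S.map (algebraMap ℝ ℂ) with hSC
  -- an eigenvector
  have hdet : (Matrix.scalar n z - qC).det = 0 := by
    rw [← Matrix.eval_charpoly]; exact hz
  obtain ⟨v, hv0, hv⟩ := Matrix.exists_mulVec_eq_zero_iff.2 hdet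
  have hqv : qC *ᵥ v = z • v := by
    rw [Matrix.sub_mulVec, sub_eq_zero] at hv
    rw [← hv, Matrix.scalar_apply, ← Matrix.smul_one_eq_diagonal, Matrix.smul_mulVec, Matrix.one_mulVec]
  -- the hermitian pairing is `qC`-invariant
  have hconj : qCᴴ = qᵀ.map (algebraMap ℝ ℂ) := by
    ext i j
    simp [hqC, Matrix.conjTranspose_apply, Matrix.map_apply, Matrix.transpose_apply, Complex.coe_algebraMap]
  have hprod : qCᴴ * SC * qC = SC := by
    rw [hconj, hSC, hqC, ← Matrix.map_mul, ← Matrix.map_mul, hq]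
  have hiso : star (qC *ᵥ v) ⬝ᵥ (SC *ᵥ (qC *ᵥ v)) = star v ⬝ᵥ (SC *ᵥ v) := by
    rw [Matrix.star_mulVec, Matrix.mulVec_mulVec, Matrix.dotProduct_mulVec, Matrix.vecMul_vecMul,
      ← Matrix.mul_assoc, hprod, ← Matrix.dotProduct_mulVec]
  -- `|z|² ⟨v,v⟩ = ⟨v,v⟩`
  have hscal : star (qC *ᵥ v) ⬝ᵥ (SC *ᵥ (qC *ᵥ v)) = (starRingEnd ℂ z * z) * (star v ⬝ᵥ (SC *ᵥ v)) := by
    rw [hqv, star_smul, Matrix.mulVec_smul, smul_dotProduct, dotProduct_smul, smul_smul, smul_eq_mul,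
      Complex.star_def]
  have hvv : star v ⬝ᵥ (SC *ᵥ v) ≠ 0 := by
    intro h
    have := re_star_dotProduct_map_mulVec_pos hS hv0
    rw [← hSC, h, Complex.zero_re] at this
    exact lt_irrefl _ this
  have h1 : starRingEnd ℂ z * z = 1 := by
    have := hiso
    rw [hscal] at this
    exact (mul_eq_right₀ hvv).1 this
  have h2 : Complex.normSq z = 1 := by
    apply Complex.ofReal_injective
    rw [Complex.normSq_eq_conj_mul_self, Complex.ofReal_one]
    exact h1
  have h3 : ‖z‖ ^ 2 = 1 := by rw [← Complex.normSq_eq_norm_sq]; exact h2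
  nlinarith [norm_nonneg z, h3]

/-! ### Unimodular algebraic integers `≡ 1 (mod N)`, `N ≥ 3`, are `1` (Kronecker + the root-of-unity congruence) -/

/-- **Kronecker + root-of-unity congruence**: let `p ∈ ℚ[X]` be non-zero with ALL complex roots of absolute value `1`,
and `λ ∈ ℂ` a root of `p` with `(λ - 1)/N` an algebraic integer, `N ≥ 3`.  Then `λ = 1`.  (By Kronecker's theorem
`λ` is a root of unity — Mathlib `NumberField.Embeddings.pow_eq_one_of_norm_eq_one` in the number field `ℚ(λ)`, all of
whose embeddings send `λ` to roots of `p` — and a root of unity `≡ 1 (mod N)`, `N ≥ 3`, is `1`: the tree's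
`RingOfIntegers.eq_one_of_isOfFinOrder_of_dvd_sub_one`.) [cite: Minkowski1887, §1] [cite: Milne2005ShimuraVarieties, §3 and Prop. 3.5] -/
theorem eq_one_of_norm_eq_one_of_isIntegral_sub_one_div {p : ℚ[X]} (hp0 : p ≠ 0)
    (hroots : ∀ z : ℂ, (p.map (algebraMap ℚ ℂ)).IsRoot z → ‖z‖ = 1) {N : ℕ} (hN : 3 ≤ N) {l : ℂ}
    (hl : (p.map (algebraMap ℚ ℂ)).IsRoot l) (hint : IsIntegral ℤ ((l - 1) / N)) : l = 1 := by
  have hN0 : (N : ℂ) ≠ 0 := by exact_mod_cast (show N ≠ 0 by omega)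
  -- `λ` is algebraic; `K = ℚ(λ)` is a number field
  have haeval : aeval l p = 0 := by
    have := hl
    rwa [Polynomial.IsRoot.def, Polynomial.eval_map, ← Polynomial.aeval_def] at this
  have hlint : IsIntegral ℚ l :=
    (isAlgebraic_iff_not_injective.mpr fun h => hp0 (h (show aeval l p = aeval l 0 by rw [haeval, map_zero]))).isIntegral
  let K : IntermediateField ℚ ℂ := IntermediateField.adjoin ℚ {l}
  haveI : FiniteDimensional ℚ K := IntermediateField.adjoin.finiteDimensional hlint
  haveI : NumberField K := NumberField.mk
  have hlK : l ∈ K := IntermediateField.mem_adjoin_simple_self ℚ l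
  have hμK : (l - 1) / N ∈ K := div_mem (sub_mem hlK (one_mem K)) (natCast_mem K N)
  set x : K := ⟨l, hlK⟩ with hx
  set μ : K := ⟨(l - 1) / N, hμK⟩ with hμ
  have hinj : Function.Injective (algebraMap K ℂ) := (algebraMap K ℂ).injective
  have hxval : algebraMap K ℂ x = l := rfl
  have hμval : algebraMap K ℂ μ = (l - 1) / N := rfl
  -- integrality of `μ` and of `x = 1 + N μ`
  have hμint : IsIntegral ℤ μ := (isIntegral_algebraMap_iff hinj).1 (by rw [hμval]; exact hint)
  have hxeq : x = 1 + (N : K) * μ := by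
    apply hinj
    rw [hxval, map_add, map_one, map_mul, map_natCast, hμval, mul_div_cancel₀ _ hN0, add_sub_cancel]
  have hNint : IsIntegral ℤ (N : K) := by
    have : IsIntegral ℤ ((N : ℤ) : K) := isIntegral_algebraMap
    simpa using this
  have hxint : IsIntegral ℤ x := by rw [hxeq]; exact isIntegral_one.add (hNint.mul hμint)
  -- every embedding of `K` sends `x` to a root of `p`, hence to the unit circle
  have hemb : ∀ φ : K →+* ℂ, ‖φ x‖ = 1 := by
    intro φ
    apply hroots
    rw [Polynomial.IsRoot.def, Polynomial.eval_map, ← Polynomial.aeval_def]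
    have h1 : aeval x p = 0 := by
      apply hinj
      rw [← Polynomial.aeval_algebraMap_apply, hxval, haeval, map_zero]
    have h2 : (φ.toRatAlgHom : K →ₐ[ℚ] ℂ) (aeval x p) = aeval ((φ.toRatAlgHom : K →ₐ[ℚ] ℂ) x) p :=
      (Polynomial.aeval_algHom_apply _ x p).symm
    have h3 : (φ.toRatAlgHom : K →ₐ[ℚ] ℂ) x = φ x := rfl
    rw [← h3, ← h2, h1, map_zero]
  -- Kronecker: `x` is a root of unity
  obtain ⟨m, hm, hxm⟩ := NumberField.Embeddings.pow_eq_one_of_norm_eq_one K ℂ hxint hemb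
  -- in `𝓞 K`: `ε = x` has finite order and `N ∣ ε - 1`, so `ε = 1`
  let ε : NumberField.RingOfIntegers K := ⟨x, hxint⟩
  let μ' : NumberField.RingOfIntegers K := ⟨μ, hμint⟩
  have hεval : algebraMap (NumberField.RingOfIntegers K) K ε = x := rfl
  have hμ'val : algebraMap (NumberField.RingOfIntegers K) K μ' = μ := rfl
  have hfin : IsOfFinOrder ε := by
    refine isOfFinOrder_iff_pow_eq_one.2 ⟨m, hm, ?_⟩
    apply NumberField.RingOfIntegers.ext
    rw [NumberField.RingOfIntegers.coe_eq_algebraMap, NumberField.RingOfIntegers.coe_eq_algebraMap, map_pow,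
      hεval, hxm, map_one]
  have hcong : (N : NumberField.RingOfIntegers K) ∣ ε - 1 := by
    refine ⟨μ', ?_⟩
    apply NumberField.RingOfIntegers.ext
    rw [NumberField.RingOfIntegers.coe_eq_algebraMap, NumberField.RingOfIntegers.coe_eq_algebraMap, map_sub,
      map_one, map_mul, map_natCast, hεval, hμ'val, hxeq, add_sub_cancel_left]
  have hε : ε = 1 :=
    Literature.NumberTheory.NumberFields.RingOfIntegers.eq_one_of_isOfFinOrder_of_dvd_sub_one hN hfin hcong
  have hx1 : x = 1 := by
    have := congrArg (algebraMap (NumberField.RingOfIntegers K) K) hε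
    rwa [map_one] at this
  rw [← hxval, hx1, map_one]

/-! ### Assembly: a rational isometry of a definite form, adelically congruent to `1 (mod N ≥ 3)`, is trivial -/

/-- **RIGIDITY**: let `S` be a positive definite real symmetric matrix and `q ∈ M_n(ℚ)` an isometry of `S`
(`qᵀ S q = S`).  If for some `N ≥ 3` the characteristic polynomial of `(q - 1)/N` has INTEGER coefficients — e.g.
because `q` is conjugate inside `GL_n(𝔸_f)` to an element `≡ 1 (mod N·ℤ̂)` of a compact open subgroup — then `q = 1`.
(Eigenvalues `λ` of `q` are unimodular with `(λ-1)/N` integral, so `λ = 1`; then `q` is a unipotent isometry, hence `1`.)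
This is the arithmetic core of «a principal congruence subgroup of level `N ≥ 3` acts freely on a hermitian symmetric
domain» with compactness and discreteness replaced by the characteristic polynomial.
[cite: Milne2005ShimuraVarieties, Prop. 3.5 and proof of Thm. 5.17] [cite: Deligne1971TravauxShimura, proof of Prop. 1.15 p. 132] [cite: Minkowski1887, §1] -/
theorem eq_one_of_isometry_of_charpoly_integral {S : Matrix n n ℝ} (hS : S.PosDef) {q : Matrix n n ℚ}
    (hq : (q.map (algebraMap ℚ ℝ))ᵀ * S * q.map (algebraMap ℚ ℝ) = S) {N : ℕ} (hN : 3 ≤ N)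
    (hP : ∃ P : ℤ[X], P.Monic ∧ P.map (Int.castRingHom ℚ) = (((N : ℚ)⁻¹ • (q - 1))).charpoly) : q = 1 := by
  obtain ⟨P, hPm, hPmap⟩ := hP
  have hN0 : (N : ℂ) ≠ 0 := by exact_mod_cast (show N ≠ 0 by omega)
  set qR : Matrix n n ℝ := q.map (algebraMap ℚ ℝ) with hqR
  set qC : Matrix n n ℂ := qR.map (algebraMap ℝ ℂ) with hqC
  have hcomp : (algebraMap ℝ ℂ).comp (algebraMap ℚ ℝ) = algebraMap ℚ ℂ := Subsingleton.elim _ _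
  have hqC' : qC = q.map (algebraMap ℚ ℂ) := by
    rw [hqC, hqR, Matrix.map_map, ← RingHom.coe_comp, hcomp]
  -- the characteristic polynomial of `q` over `ℂ`
  have hchar : (q.charpoly).map (algebraMap ℚ ℂ) = qC.charpoly := by
    rw [hqC', Matrix.charpoly_map]
  have hp0 : q.charpoly ≠ 0 := (Matrix.charpoly_monic q).ne_zero
  -- (1) all complex roots are unimodular
  have hroots : ∀ z : ℂ, ((q.charpoly).map (algebraMap ℚ ℂ)).IsRoot z → ‖z‖ = 1 := by
    intro z hz
    rw [hchar] at hz
    exact norm_eq_one_of_isRoot_charpoly_of_isometry hS hq hz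
  -- (2) `(z - 1)/N` is an algebraic integer for every complex root `z`
  have hint : ∀ z : ℂ, ((q.charpoly).map (algebraMap ℚ ℂ)).IsRoot z → IsIntegral ℤ ((z - 1) / N) := by
    intro z hz
    rw [hchar, Polynomial.IsRoot.def, Matrix.eval_charpoly] at hz
    -- `(z-1)/N` is a root of `charpoly ((q-1)/N)`, whose coefficients are those of the monic integer polynomial `P`
    have hB : (((N : ℚ)⁻¹ • (q - 1)).map (algebraMap ℚ ℂ)) = (N : ℂ)⁻¹ • (qC - 1) := by
      rw [hqC', Matrix.map_smul', Matrix.map_sub, Matrix.map_one]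
      · congr 1; simp
      all_goals simp
    have hdet : (Matrix.scalar n ((z - 1) / N) - (N : ℂ)⁻¹ • (qC - 1)).det = 0 := by
      have h1 : Matrix.scalar n ((z - 1) / N) - (N : ℂ)⁻¹ • (qC - 1) = (N : ℂ)⁻¹ • (Matrix.scalar n z - qC) := by
        ext i j
        simp only [Matrix.scalar_apply, Matrix.sub_apply, Matrix.smul_apply, Matrix.diagonal_apply, Matrix.one_apply,
          smul_eq_mul]
        split_ifs <;> field_simp <;> ring
      rw [h1, Matrix.det_smul, hz, mul_zero]
    have heval : ((((N : ℚ)⁻¹ • (q - 1)).charpoly).map (algebraMap ℚ ℂ)).eval ((z - 1) / N) = 0 := by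
      rw [← Matrix.charpoly_map, hB, Matrix.eval_charpoly, hdet]
    refine ⟨P, hPm, ?_⟩
    rw [Polynomial.eval₂_eq_eval_map]
    have hPC : P.map (algebraMap ℤ ℂ) = (((N : ℚ)⁻¹ • (q - 1)).charpoly).map (algebraMap ℚ ℂ) := by
      rw [← hPmap, Polynomial.map_map]
      congr 1
    rw [hPC, heval]
  -- (3) hence every complex root is `1`
  have hone : ∀ z ∈ (qC.charpoly).roots, z = 1 := by
    intro z hz
    have hz' : ((q.charpoly).map (algebraMap ℚ ℂ)).IsRoot z := by
      rw [hchar]; exact (Polynomial.mem_roots (Matrix.charpoly_monic qC).ne_zero).1 hz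
    exact eq_one_of_norm_eq_one_of_isIntegral_sub_one_div hp0 hroots hN hz' (hint z hz')
  -- (4) `charpoly qC = (X - 1)^k`, so `(qC - 1)^k = 0` (Cayley–Hamilton)
  have hsplit : qC.charpoly = (Multiset.map (fun a => X - C a) qC.charpoly.roots).prod :=
    (IsAlgClosed.splits qC.charpoly).eq_prod_roots_of_monic (Matrix.charpoly_monic qC)
  set k := Multiset.card qC.charpoly.roots with hk
  have hpow : qC.charpoly = (X - C 1) ^ k := by
    rw [hsplit]
    have : Multiset.map (fun a => X - C a) qC.charpoly.roots = Multiset.replicate k (X - C 1) := by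
      rw [Multiset.eq_replicate]
      refine ⟨by rw [Multiset.card_map], fun b hb => ?_⟩
      obtain ⟨a, ha, rfl⟩ := Multiset.mem_map.1 hb
      rw [hone a ha]
    rw [this, Multiset.prod_replicate]
  have hnilC : (qC - 1) ^ k = 0 := by
    have h := Matrix.aeval_self_charpoly qC
    rw [hpow, map_pow, map_sub, Polynomial.aeval_X, Polynomial.aeval_C, map_one] at h
    exact h
  -- (5) descend to `ℝ` and conclude with the unipotent-isometry lemma
  have hnilR : (qR - 1) ^ k = 0 := by
    apply Matrix.map_injective (algebraMap ℝ ℂ).injective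
    change ((qR - 1) ^ k).map (algebraMap ℝ ℂ) = (0 : Matrix n n ℝ).map (algebraMap ℝ ℂ)
    rw [Matrix.map_pow, Matrix.map_sub, Matrix.map_one (algebraMap ℝ ℂ) (map_zero _) (map_one _),
      ← hqC, hnilC, Matrix.map_zero _ (map_zero _)]
    exact fun a b => map_sub (algebraMap ℝ ℂ) a b
  have hqR1 : qR = 1 := eq_one_of_isometry_of_pow_sub_one_eq_zero hS hq hnilR
  apply Matrix.map_injective (algebraMap ℚ ℝ).injective
  change q.map (algebraMap ℚ ℝ) = (1 : Matrix n n ℚ).map (algebraMap ℚ ℝ)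
  rw [Matrix.map_one (algebraMap ℚ ℝ) (map_zero _) (map_one _), ← hqR, hqR1]

end Literature.GroupTheory.ArithmeticGroups

end
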